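import Literature.Computation.Certificates.PatakiRankBound

/-!
# Pataki's rank bound for SEVERAL semidefinite blocks (Pataki 1998, Theorem 2.2 with `q = 0`, `d = 0`),
# in rank form: an extreme point `(X₁, …, X_p)` of a block standard-form SDP has `Σ_j t(rank X_j) ≤ m`

Source: G. Pataki, *On the rank of extreme matrices in semidefinite programs and the multiplicity of optimal
eigenvalues*, Math. Oper. Res. 23 (1998) 339–358 [Pataki1998], §2, **Theorem 2.2** (p. 343; held text
`paper:doi-10-1287-moor-23-2-339` p0005, read): "Consider a semidefinite program with feasible set
`X₁ ⪰ 0, …, X_p ⪰ 0, y ∈ ℝ^q, Σ_{j=1}^p A_ij • X_j = b_i (i = 1,…,m₁), Σ_j a_ij X_j + Σ_j y_j D_ij = B_i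
(i = 1,…,m₂)` […] let `m = m₁ + Σ_i t(n_i)` […]. Suppose that `(X₁,…,X_p, y) ∈ G`, where `G` is a face of the
feasible set. Let `d = dim G`, `r_j = rank X_j` (`j = 1,…,p`). Then `Σ_{j=1}^p t(r_j) ≤ m − q + d`."
Here: the case `q = 0` (no free variables), `m₂ = 0` (scalar equality constraints only, indexed by a finite
type `κ`, so `m = |κ|`) and `d = 0` (`G` a single extreme point), with `t(r) = r(r+1)/2 = tri r` and the rank
the actual `Matrix.rank` — i.e. the statement

  `S ∈ extremePoints ℝ {S : ∀ ρ, (S ρ) ⪰ 0 ∧ ∀ i, Σ_ρ tr(A i ρ · S ρ) = c i}  ⟹  Σ_ρ t(rank (S ρ)) ≤ |κ|`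

(`sum_tri_rank_le_card_of_mem_extremePoints`; with `|κ| = f` and `t` unfolded,
`sum_rank_mul_succ_div_two_le_of_mem_extremePoints` — the typed target `HubbardAlgo.P1.PatakiRankBound` of the
certified-many-body-solver cell hubbard-algo is this statement with `κ = Fin f`).

THE PROOF is the paper's ("analogously to the proof of the first part of Theorem 2.1", p. 344), run on all
blocks at once, and reuses the single-block file `PatakiRankBound` (coordinates `symOf : ℝ^{t(r)} ≃ S^r`,
`card_upperPair`, and `exists_posDef_add_sub_smul`: `Λ ≻ 0 ⇒ Λ ± εΔ ≻ 0` for small `ε`):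
* §1 every block is factorised by the spectral theorem, `S ρ = V_ρ Λ_ρ V_ρᵀ` with `Λ_ρ ≻ 0` DIAGONAL of
  order `r_ρ = rank (S ρ)` (the nonzero eigenvalues) and `V_ρᵀ V_ρ = 1` (`exists_rank_factorization`) —
  the paper's (2.3) "we can write `X = QΛQᵀ` … `Λ ≻ 0`";
* §2 for a tuple `Δ = (Δ_ρ)` of symmetric `r_ρ × r_ρ` matrices solving the homogeneous reduced system
  `Σ_ρ tr(A i ρ · V_ρ Δ_ρ V_ρᵀ) = 0` (the multi-block (2.5)) there is ONE `ε > 0` with all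
  `Λ_ρ ± εΔ_ρ ⪰ 0` (`exists_uniform_eps`), so `S ± ε (V_ρ Δ_ρ V_ρᵀ)_ρ` are feasible ((2.6),
  `perturb_mem`) with midpoint `S`;
* §3 at an extreme point this forces `Δ = 0` (`eq_zero_of_mem_extremePoints`), i.e. the linear map
  `(ℝ^{t(r_ρ)})_ρ → ℝ^κ`, `e ↦ (Σ_ρ tr(A i ρ · V_ρ symOf(e_ρ) V_ρᵀ))_i` is injective; comparing dimensions
  (`Module.finrank_pi_fintype`, `card_upperPair`) gives `Σ_ρ t(r_ρ) ≤ |κ|` (§4).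

Everything is PROVED; no definition besides the feasible set `blockFeasible` and the linear map of §3; no
named fact. NOT HERE: faces of positive dimension (`+ d`), free variables (`− q`), matrix-valued equality
constraints (`m₂ > 0`), and the dual form Thm 2.1 (2).
-/

noncomputable section

namespace Literature.Computation.Certificates.PatakiRankBoundBlocks

open Matrix Finset
open PatakiRankBound (tri UpperPair card_upperPair symOf symOfLin symOfLin_apply symOf_injective
  isHermitian_symOf exists_posDef_add_sub_smul)

variable {ι : Type*} [Fintype ι]
variable {nρ : ι → Type*} [∀ ρ, Fintype (nρ ρ)]
variable {κ : Type*}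

/-! ## §0 The block standard-form feasible set -/

/-- The feasible set `{(X_ρ)_ρ : X_ρ ⪰ 0 ∀ρ, Σ_ρ A_{iρ} • X_ρ = c_i ∀ i}` of a semidefinite program with several
semidefinite blocks and scalar equality constraints (Thm 2.2 with `q = 0`, `m₂ = 0`).
[cite: Pataki1998, §2 Thm. 2.2 (feasible set)] -/
def blockFeasible (A : κ → ∀ ρ, Matrix (nρ ρ) (nρ ρ) ℝ) (c : κ → ℝ) :
    Set (∀ ρ, Matrix (nρ ρ) (nρ ρ) ℝ) :=
  {S | (∀ ρ, (S ρ).PosSemidef) ∧ ∀ i, ∑ ρ, (A i ρ * S ρ).trace = c i}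

/-- Membership in the block feasible set. [cite: Pataki1998, §2 Thm. 2.2 (feasible set)] -/
theorem mem_blockFeasible_iff {A : κ → ∀ ρ, Matrix (nρ ρ) (nρ ρ) ℝ} {c : κ → ℝ}
    {S : ∀ ρ, Matrix (nρ ρ) (nρ ρ) ℝ} :
    S ∈ blockFeasible A c ↔ (∀ ρ, (S ρ).PosSemidef) ∧ ∀ i, ∑ ρ, (A i ρ * S ρ).trace = c i :=
  Iff.rfl

/-! ## §1 Spectral factorisation `X = V Λ Vᵀ`, `Λ ≻ 0` diagonal of order `rank X`, `VᵀV = 1` -/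

section Factorization

variable {m : Type*} [Fintype m] [DecidableEq m]

omit [DecidableEq m] in
/-- Dropping the zero terms of a finite sum: `Σ_i f i = Σ_{i : {i // w i ≠ 0}} f i` when `f i = 0` wherever
`w i = 0`. [folklore] -/
private theorem sum_eq_sum_subtype_ne_zero {w : m → ℝ} {f : m → ℝ} (hf : ∀ i, w i = 0 → f i = 0) :
    ∑ i, f i = ∑ i : {i // w i ≠ 0}, f i.1 := by
  classical
  rw [← Finset.sum_subtype (Finset.univ.filter fun i => w i ≠ 0) (p := fun i => w i ≠ 0)
    (fun i => by simp)]
  rw [Finset.sum_filter]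
  refine Finset.sum_congr rfl fun i _ => ?_
  by_cases h : w i = 0
  · simp [h, hf i h]
  · simp [h]

/-- "Since `rank X = r`, we can write `X = QΛQᵀ` where `Q ∈ ℝ^{n×r}`, `Λ ∈ S^r`, `Λ ≻ 0`" — for a positive
semidefinite real `X`, by the spectral theorem: `X = V · diag(d) · Vᵀ` with `d > 0` the nonzero eigenvalues,
`r = rank X` of them, and `V` (the corresponding eigenvectors) with orthonormal columns, `VᵀV = 1`.
[cite: Pataki1998, §2 proof of Thm. 2.1, eq. (2.3)] -/
theorem exists_rank_factorization {X : Matrix m m ℝ} (hX : X.PosSemidef) :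
    ∃ (r : ℕ) (V : Matrix m (Fin r) ℝ) (d : Fin r → ℝ),
      X.rank = r ∧ (∀ k, 0 < d k) ∧ Vᵀ * V = 1 ∧ X = V * diagonal d * Vᵀ := by
  have hH : X.IsHermitian := hX.1
  set e := hH.eigenvalues with he
  let U : Matrix m m ℝ := (hH.eigenvectorUnitary : Matrix m m ℝ)
  have hUU : Uᵀ * U = 1 := by
    have h := Unitary.coe_star_mul_self hH.eigenvectorUnitary
    rwa [star_eq_conjTranspose, conjTranspose_eq_transpose_of_trivial] at h
  have hspec : X = U * diagonal e * Uᵀ := by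
    have h := hH.spectral_theorem
    rw [Unitary.conjStarAlgAut_apply, star_eq_conjTranspose, conjTranspose_eq_transpose_of_trivial] at h
    simpa [RCLike.ofReal_real_eq_id] using h
  -- the nonzero eigenvalues
  let s := {i // e i ≠ 0}
  let r := Fintype.card s
  let φ : s ≃ Fin r := Fintype.equivFin s
  refine ⟨r, fun a k => U a (φ.symm k).1, fun k => e (φ.symm k).1, ?_, ?_, ?_, ?_⟩
  · exact hH.rank_eq_card_non_zero_eigs
  · intro k
    exact lt_of_le_of_ne (hX.eigenvalues_nonneg _) (Ne.symm (φ.symm k).2)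
  · ext k l
    have h := congr_fun (congr_fun hUU (φ.symm k).1) (φ.symm l).1
    simp only [mul_apply, transpose_apply, one_apply] at h ⊢
    rw [h]
    by_cases hkl : k = l
    · subst hkl; simp
    · have : (φ.symm k).1 ≠ (φ.symm l).1 := fun h' =>
        hkl (φ.symm.injective (Subtype.ext h'))
      simp [hkl, this]
  · ext a b
    rw [hspec]
    simp only [mul_apply, diagonal, transpose_apply, of_apply, mul_ite, mul_zero, Finset.sum_ite_eq',
      Finset.mem_univ, if_true]
    -- `Σ_i U a i e i U b i = Σ_{k : Fin r} U a (φ⁻¹ k) e (φ⁻¹ k) U b (φ⁻¹ k)`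
    rw [sum_eq_sum_subtype_ne_zero (w := e) (f := fun i => U a i * e i * U b i)
      (fun i hi => by simp [hi])]
    exact (Fintype.sum_equiv φ.symm _ _ fun k => rfl).symm

end Factorization

/-! ## §2 The perturbation `S ± ε (V_ρ Δ_ρ V_ρᵀ)_ρ` stays feasible -/

/-- `Λ ⪰ 0` and `Λ + ε₀Δ ⪰ 0` give `Λ + εΔ ⪰ 0` for `0 ≤ ε ≤ ε₀` (convexity of the cone). [folklore] -/
private theorem posSemidef_add_smul_of_le {p : Type*} [Fintype p] {Λ Δ : Matrix p p ℝ} (hΛ : Λ.PosSemidef)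
    {ε₀ ε : ℝ} (h₀ : (Λ + ε₀ • Δ).PosSemidef) (hε : 0 ≤ ε) (hle : ε ≤ ε₀) : (Λ + ε • Δ).PosSemidef := by
  rcases eq_or_lt_of_le hε with h | hpos
  · rw [← h, zero_smul, add_zero]; exact hΛ
  have hε₀ : 0 < ε₀ := lt_of_lt_of_le hpos hle
  have key : Λ + ε • Δ = (1 - ε / ε₀) • Λ + (ε / ε₀) • (Λ + ε₀ • Δ) := by
    rw [smul_add, smul_smul, div_mul_cancel₀ ε hε₀.ne']
    module
  rw [key]
  refine PosSemidef.add (hΛ.smul ?_) (h₀.smul ?_)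
  · exact sub_nonneg.mpr ((div_le_one hε₀).mpr hle)
  · exact (div_pos hpos hε₀).le

/-- ONE `ε > 0` for all blocks: if every `Λ_ρ ≻ 0` and every `Δ_ρ` is symmetric then for some `ε > 0` all
`Λ_ρ + εΔ_ρ` and `Λ_ρ − εΔ_ρ` are positive semidefinite (the paper's "there exists `ε > 0` such that
`Λ ± εD_j ⪰ 0`", uniformly over the finitely many blocks).
[cite: Pataki1998, §2 proof of Thm. 2.1, between (2.5) and (2.6)] -/
theorem exists_uniform_eps {r : ι → ℕ} {Λ Δ : ∀ ρ, Matrix (Fin (r ρ)) (Fin (r ρ)) ℝ}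
    (hΛ : ∀ ρ, (Λ ρ).PosDef) (hΔ : ∀ ρ, (Δ ρ).IsHermitian) :
    ∃ ε : ℝ, 0 < ε ∧ ∀ ρ, (Λ ρ + ε • Δ ρ).PosSemidef ∧ (Λ ρ - ε • Δ ρ).PosSemidef := by
  have hρ : ∀ ρ, ∃ ε : ℝ, 0 < ε ∧ (Λ ρ + ε • Δ ρ).PosDef ∧ (Λ ρ - ε • Δ ρ).PosDef :=
    fun ρ => exists_posDef_add_sub_smul (hΛ ρ) (hΔ ρ)
  choose ε hεpos hεadd hεsub using hρ
  rcases isEmpty_or_nonempty ι with hι | hι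
  · exact ⟨1, one_pos, fun ρ => (hι.false ρ).elim⟩
  obtain ⟨ρ₀, -, hmin⟩ := Finset.exists_min_image Finset.univ ε Finset.univ_nonempty
  refine ⟨ε ρ₀, hεpos ρ₀, fun ρ => ⟨?_, ?_⟩⟩
  · exact posSemidef_add_smul_of_le (hΛ ρ).posSemidef (hεadd ρ).posSemidef (hεpos ρ₀).le
      (hmin ρ (Finset.mem_univ ρ))
  · have h := posSemidef_add_smul_of_le (Δ := -Δ ρ) (hΛ ρ).posSemidef
      (by simpa [sub_eq_add_neg] using (hεsub ρ).posSemidef) (hεpos ρ₀).le (hmin ρ (Finset.mem_univ ρ))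
    simpa [sub_eq_add_neg] using h

omit [Fintype ι] in
/-- `V M Vᵀ ⪰ 0` for `M ⪰ 0`. [folklore] -/
private theorem posSemidef_conj {ρ : ι} {r : ℕ} (V : Matrix (nρ ρ) (Fin r) ℝ) {M : Matrix (Fin r) (Fin r) ℝ}
    (hM : M.PosSemidef) : (V * M * Vᵀ).PosSemidef := by
  simpa [conjTranspose_eq_transpose_of_trivial] using hM.mul_mul_conjTranspose_same V

/-- (2.6), all blocks at once: if `S ρ = V_ρ Λ_ρ V_ρᵀ` is feasible, `Λ_ρ ± εΔ_ρ ⪰ 0` for all `ρ`, and `Δ` solves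
the homogeneous reduced system `Σ_ρ tr(A i ρ · V_ρ Δ_ρ V_ρᵀ) = 0` ((2.5)), then BOTH points
`S ± ε (V_ρ Δ_ρ V_ρᵀ)_ρ` are feasible. [cite: Pataki1998, §2 proof of Thm. 2.1, eqs. (2.5)–(2.6)] -/
theorem perturb_mem {A : κ → ∀ ρ, Matrix (nρ ρ) (nρ ρ) ℝ} {c : κ → ℝ} {r : ι → ℕ}
    {V : ∀ ρ, Matrix (nρ ρ) (Fin (r ρ)) ℝ} {Λ Δ : ∀ ρ, Matrix (Fin (r ρ)) (Fin (r ρ)) ℝ}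
    {S : ∀ ρ, Matrix (nρ ρ) (nρ ρ) ℝ} (hS : S ∈ blockFeasible A c) (hfac : ∀ ρ, S ρ = V ρ * Λ ρ * (V ρ)ᵀ)
    {ε : ℝ} (hε : ∀ ρ, (Λ ρ + ε • Δ ρ).PosSemidef ∧ (Λ ρ - ε • Δ ρ).PosSemidef)
    (hker : ∀ i, ∑ ρ, (A i ρ * (V ρ * Δ ρ * (V ρ)ᵀ)).trace = 0) :
    (fun ρ => S ρ + ε • (V ρ * Δ ρ * (V ρ)ᵀ)) ∈ blockFeasible A c ∧
      (fun ρ => S ρ - ε • (V ρ * Δ ρ * (V ρ)ᵀ)) ∈ blockFeasible A c := by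
  have hplus : ∀ ρ, S ρ + ε • (V ρ * Δ ρ * (V ρ)ᵀ) = V ρ * (Λ ρ + ε • Δ ρ) * (V ρ)ᵀ := by
    intro ρ; rw [hfac ρ, Matrix.mul_add, Matrix.add_mul, Matrix.mul_smul, Matrix.smul_mul]
  have hminus : ∀ ρ, S ρ - ε • (V ρ * Δ ρ * (V ρ)ᵀ) = V ρ * (Λ ρ - ε • Δ ρ) * (V ρ)ᵀ := by
    intro ρ; rw [hfac ρ, Matrix.mul_sub, Matrix.sub_mul, Matrix.mul_smul, Matrix.smul_mul]
  have hlin : ∀ i (σ : ℝ), ∑ ρ, (A i ρ * (S ρ + σ • (V ρ * Δ ρ * (V ρ)ᵀ))).trace = c i := by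
    intro i σ
    have h1 : ∀ ρ, (A i ρ * (S ρ + σ • (V ρ * Δ ρ * (V ρ)ᵀ))).trace
        = (A i ρ * S ρ).trace + σ * (A i ρ * (V ρ * Δ ρ * (V ρ)ᵀ)).trace := by
      intro ρ; rw [Matrix.mul_add, trace_add, Matrix.mul_smul, trace_smul, smul_eq_mul]
    simp only [h1, Finset.sum_add_distrib, ← Finset.mul_sum, hker i, mul_zero, add_zero]
    exact hS.2 i
  refine ⟨⟨fun ρ => ?_, fun i => hlin i ε⟩, ⟨fun ρ => ?_, fun i => ?_⟩⟩
  · show (S ρ + ε • (V ρ * Δ ρ * (V ρ)ᵀ)).PosSemidef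
    rw [hplus ρ]; exact posSemidef_conj (V ρ) (hε ρ).1
  · show (S ρ - ε • (V ρ * Δ ρ * (V ρ)ᵀ)).PosSemidef
    rw [hminus ρ]; exact posSemidef_conj (V ρ) (hε ρ).2
  · have := hlin i (-ε)
    simpa [sub_eq_add_neg] using this

/-! ## §3 At an extreme point the reduced homogeneous system has only the trivial symmetric solution -/

/-- THE EXTREME-POINT STEP: with `S ρ = V_ρ Λ_ρ V_ρᵀ` feasible, `Λ_ρ ≻ 0`, `V_ρᵀ V_ρ = 1`, every tuple of
symmetric `Δ_ρ` solving `Σ_ρ tr(A i ρ · V_ρ Δ_ρ V_ρᵀ) = 0` for all `i` vanishes if `S` is an extreme point of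
the feasible set (otherwise `S` is the midpoint of the two feasible points of `perturb_mem`).
[cite: Pataki1998, §2 proof of Thm. 2.1, eqs. (2.4)–(2.6)] -/
theorem eq_zero_of_mem_extremePoints {A : κ → ∀ ρ, Matrix (nρ ρ) (nρ ρ) ℝ} {c : κ → ℝ} {r : ι → ℕ}
    {V : ∀ ρ, Matrix (nρ ρ) (Fin (r ρ)) ℝ} {Λ Δ : ∀ ρ, Matrix (Fin (r ρ)) (Fin (r ρ)) ℝ}
    {S : ∀ ρ, Matrix (nρ ρ) (nρ ρ) ℝ} (hS : S ∈ Set.extremePoints ℝ (blockFeasible A c))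
    (hfac : ∀ ρ, S ρ = V ρ * Λ ρ * (V ρ)ᵀ) (hΛ : ∀ ρ, (Λ ρ).PosDef) (hVV : ∀ ρ, (V ρ)ᵀ * V ρ = 1)
    (hΔ : ∀ ρ, (Δ ρ).IsHermitian) (hker : ∀ i, ∑ ρ, (A i ρ * (V ρ * Δ ρ * (V ρ)ᵀ)).trace = 0) :
    Δ = 0 := by
  obtain ⟨ε, hεpos, hε⟩ := exists_uniform_eps hΛ hΔ
  rw [mem_extremePoints] at hS
  obtain ⟨hSmem, hext⟩ := hS
  obtain ⟨hplus, hminus⟩ := perturb_mem hSmem hfac hε hker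
  set W : ∀ ρ, Matrix (nρ ρ) (nρ ρ) ℝ := fun ρ => V ρ * Δ ρ * (V ρ)ᵀ with hW
  have hseg : S ∈ openSegment ℝ (fun ρ => S ρ + ε • W ρ) (fun ρ => S ρ - ε • W ρ) := by
    refine ⟨1 / 2, 1 / 2, by norm_num, by norm_num, by norm_num, ?_⟩
    funext ρ
    simp only [Pi.add_apply, Pi.smul_apply]
    module
  have h1 : (fun ρ => S ρ + ε • W ρ) = S := (hext _ hplus _ hminus hseg).1
  funext ρ
  have h2 : ε • W ρ = 0 := by
    have := congr_fun h1 ρ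
    simpa using this
  have hW0 : W ρ = 0 := by
    rcases smul_eq_zero.mp h2 with h | h
    · exact absurd h hεpos.ne'
    · exact h
  -- `Δ_ρ = V_ρᵀ (V_ρ Δ_ρ V_ρᵀ) V_ρ = 0`
  have : Δ ρ = (V ρ)ᵀ * W ρ * V ρ := by
    simp only [hW]
    rw [← Matrix.mul_assoc, ← Matrix.mul_assoc, hVV, Matrix.one_mul, Matrix.mul_assoc, hVV,
      Matrix.mul_one]
  rw [this, hW0, Matrix.mul_zero, Matrix.zero_mul]
  rfl

/-! ## §4 Dimension count: `Σ_ρ t(r_ρ) ≤ |κ|` -/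

/-- The reduced constraint map on upper-triangular coordinates, all blocks at once:
`e = (e_ρ)_ρ ↦ (Σ_ρ tr(A i ρ · V_ρ symOf(e_ρ) V_ρᵀ))_i`, a linear map `(Π_ρ ℝ^{t(r_ρ)}) → ℝ^κ`.
[cite: Pataki1998, §2 proof of Thm. 2.1, eq. (2.4)] -/
def blockConstraintMap (A : κ → ∀ ρ, Matrix (nρ ρ) (nρ ρ) ℝ) {r : ι → ℕ}
    (V : ∀ ρ, Matrix (nρ ρ) (Fin (r ρ)) ℝ) : (∀ ρ, UpperPair (r ρ) → ℝ) →ₗ[ℝ] (κ → ℝ) where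
  toFun e i := ∑ ρ, (A i ρ * (V ρ * symOf (e ρ) * (V ρ)ᵀ)).trace
  map_add' e₁ e₂ := by
    funext i
    simp only [Pi.add_apply]
    rw [← Finset.sum_add_distrib]
    refine Finset.sum_congr rfl fun ρ _ => ?_
    rw [← symOfLin_apply, map_add, symOfLin_apply, symOfLin_apply, Matrix.mul_add, Matrix.add_mul,
      Matrix.mul_add, trace_add]
  map_smul' a e := by
    funext i
    simp only [Pi.smul_apply, smul_eq_mul, RingHom.id_apply]
    rw [Finset.mul_sum]
    refine Finset.sum_congr rfl fun ρ _ => ?_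
    rw [← symOfLin_apply, map_smul, symOfLin_apply, Matrix.mul_smul, Matrix.smul_mul, Matrix.mul_smul,
      trace_smul, smul_eq_mul]

/-- At an extreme point the reduced constraint map is injective on symmetric coordinates.
[cite: Pataki1998, §2 proof of Thm. 2.1, eqs. (2.4)–(2.6)] -/
theorem injective_blockConstraintMap {A : κ → ∀ ρ, Matrix (nρ ρ) (nρ ρ) ℝ} {c : κ → ℝ} {r : ι → ℕ}
    {V : ∀ ρ, Matrix (nρ ρ) (Fin (r ρ)) ℝ} {Λ : ∀ ρ, Matrix (Fin (r ρ)) (Fin (r ρ)) ℝ}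
    {S : ∀ ρ, Matrix (nρ ρ) (nρ ρ) ℝ} (hS : S ∈ Set.extremePoints ℝ (blockFeasible A c))
    (hfac : ∀ ρ, S ρ = V ρ * Λ ρ * (V ρ)ᵀ) (hΛ : ∀ ρ, (Λ ρ).PosDef) (hVV : ∀ ρ, (V ρ)ᵀ * V ρ = 1) :
    Function.Injective (blockConstraintMap A V) := by
  refine (injective_iff_map_eq_zero _).mpr fun e he => ?_
  have hΔ : (fun ρ => symOf (e ρ)) = 0 :=
    eq_zero_of_mem_extremePoints hS hfac hΛ hVV (fun ρ => isHermitian_symOf (e ρ))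
      (fun i => congr_fun he i)
  funext ρ
  have h : symOf (e ρ) = symOf (0 : UpperPair (r ρ) → ℝ) := by
    have h0 : symOf (0 : UpperPair (r ρ) → ℝ) = 0 := by
      rw [← symOfLin_apply, map_zero]
    rw [h0]; exact congr_fun hΔ ρ
  exact symOf_injective (r ρ) h

/-- **Theorem 2.2 (Pataki 1998), `q = 0`, `d = 0`, rank form.** If `S = (S_ρ)_ρ` is an extreme point of the
feasible set `{S : S_ρ ⪰ 0 ∀ρ, Σ_ρ A_{iρ} • S_ρ = c_i ∀ i ∈ κ}` of a block standard-form semidefinite program,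
then `Σ_ρ t(rank S_ρ) ≤ |κ|` (`t(r) = r(r+1)/2`). [cite: Pataki1998, §2 Thm. 2.2] -/
theorem sum_tri_rank_le_card_of_mem_extremePoints [∀ ρ, DecidableEq (nρ ρ)] [Fintype κ]
    {A : κ → ∀ ρ, Matrix (nρ ρ) (nρ ρ) ℝ} {c : κ → ℝ}
    {S : ∀ ρ, Matrix (nρ ρ) (nρ ρ) ℝ} (hS : S ∈ Set.extremePoints ℝ (blockFeasible A c)) :
    ∑ ρ, tri ((S ρ).rank) ≤ Fintype.card κ := by
  have hSmem : S ∈ blockFeasible A c := hS.1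
  have hfac := fun ρ => exists_rank_factorization (hSmem.1 ρ)
  choose r V d hrank hdpos hVV hSeq using hfac
  -- the factorisation `S ρ = V_ρ diag(d_ρ) V_ρᵀ` with `diag(d_ρ) ≻ 0`
  have hΛ : ∀ ρ, (diagonal (d ρ)).PosDef := fun ρ => Matrix.posDef_diagonal_iff.mpr (hdpos ρ)
  have hinj := injective_blockConstraintMap (Λ := fun ρ => diagonal (d ρ)) hS hSeq hΛ hVV
  have hdim := LinearMap.finrank_le_finrank_of_injective hinj
  rw [Module.finrank_pi_fintype ℝ, Module.finrank_fintype_fun_eq_card] at hdim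
  simp only [Module.finrank_fintype_fun_eq_card, card_upperPair] at hdim
  calc ∑ ρ, tri ((S ρ).rank) = ∑ ρ, tri (r ρ) := Finset.sum_congr rfl fun ρ _ => by rw [hrank ρ]
    _ ≤ Fintype.card κ := hdim

/-- The same with `t` unfolded and `κ = Fin f`: an extreme point of a block standard-form SDP with `f` scalar
equality constraints obeys the FEW-SQUARES BUDGET `Σ_ρ rank(S_ρ)(rank(S_ρ)+1)/2 ≤ f` (the typed target
`HubbardAlgo.P1.PatakiRankBound` of cell hubbard-algo is this statement verbatim). [cite: Pataki1998, §2 Thm. 2.2] -/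
theorem sum_rank_mul_succ_div_two_le_of_mem_extremePoints [∀ ρ, DecidableEq (nρ ρ)] {f : ℕ}
    {A : Fin f → ∀ ρ, Matrix (nρ ρ) (nρ ρ) ℝ}
    {c : Fin f → ℝ} {S : ∀ ρ, Matrix (nρ ρ) (nρ ρ) ℝ} (hS : S ∈ Set.extremePoints ℝ (blockFeasible A c)) :
    ∑ ρ, (S ρ).rank * ((S ρ).rank + 1) / 2 ≤ f := by
  have h := sum_tri_rank_le_card_of_mem_extremePoints hS
  simpa [tri, Fintype.card_fin] using h

end Literature.Computation.Certificates.PatakiRankBoundBlocks
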